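import Mathlib
import Summits.AtomisticToContinuum.HydrodynamicLimit.Theorems.InformationPercolationEngineKickFairRelEquilibriumMesoNoLastCollision
import Summits.AtomisticToContinuum.HydrodynamicLimit.Theorems.InformationPercolationEngineKickFairRelEquilibriumMesoTransferAE
import Summits.AtomisticToContinuum.HydrodynamicLimit.Theorems.InformationPercolationEngineKickFairRelEquilibriumMesoSlotSumIntegrable
import Summits.AtomisticToContinuum.HydrodynamicLimit.Theorems.InformationPercolationEngineKickFairRelEquilibriumMesoFirstKickFair
import HarnessLib

/-!
# `KickFairRelEquilibriumMeso`, line `Sketch` — KICKS ARE EXACTLY FAIR GIVEN THEIR OWN PAST UNDER THE INVARIANT LAW,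
# FOR EVERY INDEX (the equilibrium, un-pinched form of the restart-bias stub R-i″, proved)

Helper file (`--supports stmt-AtomisticToContinuum-15177`, registered sub-goal `integral_slotSum_eq_zero`) of the line lead
(continuation c2). The restart-bias stub `stub_restartBiasCut` asks that the windowed, past-weighted, `G`-centred kick sum
`Z_{(t₁,t₂]}` have small `G`-mean on `LG`-typical level sets `B` of the time-zero key. This file proves the statements that hold
EXACTLY and for EVERY collision index `n` (so far only `n = 0` was on file, `firstKickFair`):

* `integral_pastFn_mul_sub_kappa_eq_zero` — the pull-out: every bounded measurable function of the typed past `P_{i,n}` is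
  orthogonal to the centred kick `g(X_{i,n}) − κ_{i,n}` (defining property of Mathlib's `condExp`; no dynamics);
* `integral_windowTerm_eq_zero` — every summand `1{n < cnt_i(τ)} 1{t_{i,n} ∈ (t₁,t₂]} h(P_{i,n}) (g(X_{i,n}) − κ_{i,n})` of the
  crux's windowed sum has `G`-mean ZERO: by NO LAST COLLISION (`ae_lt_cnt_iff_mem_Ioc` of `…MesoNoLastCollision`) the cut
  `{n < cnt_i}` is `G`-a.e. the past-measurable event `{t_{i,n} ∈ (0, τ]}`;
* `integral_slotSum_eq_zero` — hence **`∫ Z_{(t₁,t₂]} dG = 0`** for every horizon, mesh, window, bounded continuous `g` and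
  measurable weights `|h| ≤ 1` (`σ` below the integrability threshold, `N ≥ 1`): the random number of summands is exchanged
  with the integral by dominated convergence against `2C · countFn` (integrable, `exists_integrable_countFn`). This is R-i″
  with the level set replaced by the whole space — what remains of R-i″ is a POSTERIOR-STABILITY statement: the bias on `B` is
  `E_G[h(P) g(X) (G[B | P, X] − G[B | P])]`, i.e. how much ONE impact vector changes the posterior odds of the time-zero key;
* `partnerFirstFlightFair` — and on key level sets the kicks by partners on their FIRST flight (`s_q = 0`) are exactly fair for
  every `n` (the second photo of the past is then the time-zero coarse configuration, `past_snd_photo`): the content of R-i″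
  lies entirely in collisions between two spheres that have BOTH collided before.
-/

noncomputable section

open MeasureTheory Set Filter Topology
open scoped ENNReal Classical

namespace Summit.AtomisticToContinuum.HydrodynamicLimit.Theorems.KickFairRelEquilibriumMesoLine

open Literature.Analysis.FluidPDE Literature.MathematicalPhysics.KineticTheory
open Summit.AtomisticToContinuum.HydrodynamicLimit.Theorems

/-! ## Exact fairness of every centred kick term given its own past  -/

section Fair

variable {σ : ℝ} {N : ℕ}

/-- **Pull-out: every bounded measurable function of the typed past is orthogonal to the centred kick**, for EVERY
index `n`: `∫ F(P_{i,n}) (g(X_{i,n}) − κ_{i,n}) dG = 0` under the invariant law `G = localGibbsLaw σ 1 0 1 N Φ`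
(`0 < σ ≤ 1/2`), `κ_{i,n} = E_G[g(X_{i,n}) | σ(P_{i,n})]` (the defining property of the conditional expectation and
`condExp_mul_of_stronglyMeasurable_left`; no dynamics). [folklore] -/
theorem integral_pastFn_mul_sub_kappa_eq_zero (hσ : 0 < σ) (hσ2 : σ ≤ 1 / 2) (Φ : Flow σ N) (r : ℝ)
    {g : V3 × V3 × V3 → ℝ} (hg : Continuous g) (hgb : ∃ C : ℝ, ∀ p, |g p| ≤ C) (i : Fin (N + 1)) (n : ℕ)
    {F : Past N → ℝ} (hFm : Measurable F) (hFb : ∃ CF : ℝ, ∀ p, |F p| ≤ CF) :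
    ∫ z, F (past Φ r z i n) * (g (kick Φ i n z) - kappa Φ r g i n z)
      ∂(localGibbsLaw σ (fun _ => 1) (fun _ => 0) (fun _ => 1) N Φ) = 0 := by
  obtain ⟨C, hC⟩ := hgb
  obtain ⟨CF, hCF⟩ := hFb
  set ν : Measure (Phase N) := localGibbsLaw σ (fun _ => (1 : ℝ)) (fun _ => (0 : V3)) (fun _ => (1 : ℝ)) N Φ with hν
  haveI : IsProbabilityMeasure ν := isProbabilityMeasure_localGibbsLaw continuous_const continuous_const
    continuous_const (fun _ => one_pos) (fun _ => one_pos) hσ2 N Φ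
  have hPm : Measurable (fun z => past Φ r z i n) := (stub_pastMeasurable σ hσ N Φ r 0 i n).1
  have hmle : MeasurableSpace.comap (fun z => past Φ r z i n) inferInstance ≤
      (inferInstance : MeasurableSpace (Phase N)) := comap_past_le stub_pastMeasurable hσ Φ r i n
  have hPm' : Measurable[MeasurableSpace.comap (fun z => past Φ r z i n) inferInstance] (fun z => past Φ r z i n) :=
    measurable_iff_comap_le.2 le_rfl
  have hfm : Measurable[MeasurableSpace.comap (fun z => past Φ r z i n) inferInstance] (fun z => F (past Φ r z i n)) :=
    hFm.comp hPm'
  have hfm0 : Measurable (fun z => F (past Φ r z i n)) := hFm.comp hPm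
  have hfb : ∀ᵐ z ∂ν, ‖F (past Φ r z i n)‖ ≤ |CF| :=
    Eventually.of_forall fun z => by rw [Real.norm_eq_abs]; exact (hCF _).trans (le_abs_self _)
  have hgkm : Measurable (fun z => g (kick Φ i n z)) := hg.measurable.comp (stub_pastMeasurable σ hσ N Φ r 0 i n).2.1
  have hgkint : Integrable (fun z => g (kick Φ i n z)) ν :=
    Integrable.of_bound hgkm.aestronglyMeasurable C (Eventually.of_forall fun z => by
      rw [Real.norm_eq_abs]; exact hC _)
  have hκ : kappa Φ r g i n =
      ν[(fun z => g (kick Φ i n z)) | MeasurableSpace.comap (fun z => past Φ r z i n) inferInstance] := rfl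
  have hfgint : Integrable (fun z => F (past Φ r z i n) * g (kick Φ i n z)) ν :=
    hgkint.bdd_mul hfm0.aestronglyMeasurable hfb
  have hfκint : Integrable (fun z => F (past Φ r z i n) * kappa Φ r g i n z) ν := by
    rw [hκ]; exact integrable_condExp.bdd_mul hfm0.aestronglyMeasurable hfb
  have hpull : ∫ z, F (past Φ r z i n) * kappa Φ r g i n z ∂ν = ∫ z, F (past Φ r z i n) * g (kick Φ i n z) ∂ν := by
    rw [hκ]
    calc ∫ z, F (past Φ r z i n) *
          (ν[(fun z => g (kick Φ i n z)) | MeasurableSpace.comap (fun z => past Φ r z i n) inferInstance]) z ∂ν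
        = ∫ z, (ν[(fun z => F (past Φ r z i n) * g (kick Φ i n z)) |
            MeasurableSpace.comap (fun z => past Φ r z i n) inferInstance]) z ∂ν :=
          integral_congr_ae (condExp_mul_of_stronglyMeasurable_left (f := fun z => F (past Φ r z i n))
            (g := fun z => g (kick Φ i n z)) hfm.stronglyMeasurable hfgint hgkint).symm
      _ = ∫ z, F (past Φ r z i n) * g (kick Φ i n z) ∂ν := integral_condExp hmle
  simp_rw [mul_sub]
  rw [integral_sub hfgint hfκint, hpull, sub_self]

/-- **Every windowed, past-weighted, centred kick term of the crux has `G`-mean zero — for EVERY index `n`**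
(so far only `n = 0`, `firstKickFair`): `∫ 1{n < cnt_i(τ)} 1{t_{i,n} ∈ (t₁,t₂]} h_{i,n}(P_{i,n}) (g(X_{i,n}) − κ_{i,n}) dG
= 0` under the invariant law, for every horizon, mesh, window, bounded continuous `g` and measurable bounded weight.
Proof: `G`-a.e. the cut `{n < cnt_i}` is `{t_{i,n} ∈ (0, τ]}` (`ae_lt_cnt_iff_mem_Ioc`: no last collision), and on the good
set `t_{i,n}` is the last component of the past, so the whole weight is a bounded measurable function of `P_{i,n}` and
`integral_pastFn_mul_sub_kappa_eq_zero` applies. [folklore] -/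
theorem integral_windowTerm_eq_zero (hσ : 0 < σ) (hσ2 : σ ≤ 1 / 2) (Φ : Flow σ N) (τ r t₁ t₂ : ℝ)
    {g : V3 × V3 × V3 → ℝ} (hg : Continuous g) (hgb : ∃ C : ℝ, ∀ p, |g p| ≤ C)
    {h : Fin (N + 1) → ℕ → Past N → ℝ} (hh : ∀ i n, Measurable (h i n)) (hhb : ∃ Ch : ℝ, ∀ i n p, |h i n p| ≤ Ch)
    (i : Fin (N + 1)) (n : ℕ) :
    ∫ z, (if n < cnt Φ τ z i then
        (if t₁ < Φ.nthCollisionTimeOf i n z ∧ Φ.nthCollisionTimeOf i n z ≤ t₂ then (1 : ℝ) else 0) *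
          (h i n (past Φ r z i n) * (g (kick Φ i n z) - kappa Φ r g i n z)) else 0)
      ∂(localGibbsLaw σ (fun _ => 1) (fun _ => 0) (fun _ => 1) N Φ) = 0 := by
  obtain ⟨Ch, hCh⟩ := hhb
  set ν : Measure (Phase N) := localGibbsLaw σ (fun _ => (1 : ℝ)) (fun _ => (0 : V3)) (fun _ => (1 : ℝ)) N Φ with hν
  -- the weight as a function of the past
  set S : Set (Past N) := {p | p.2.2.2 ∈ Ioc 0 τ ∧ (t₁ < p.2.2.2 ∧ p.2.2.2 ≤ t₂)} with hSdef
  have htime : Measurable fun p : Past N => p.2.2.2 := measurable_snd.snd.snd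
  have hSm : MeasurableSet S :=
    (htime measurableSet_Ioc).inter ((measurableSet_lt measurable_const htime).inter (measurableSet_le htime measurable_const))
  set F : Past N → ℝ := fun p => S.indicator (fun _ => (1 : ℝ)) p * h i n p with hFdef
  have hFm : Measurable F := (measurable_const.indicator hSm).mul (hh i n)
  have hFb : ∃ CF : ℝ, ∀ p, |F p| ≤ CF := by
    refine ⟨|Ch|, fun p => ?_⟩
    rw [hFdef]; dsimp only
    rw [abs_mul]
    have h1 : |S.indicator (fun _ => (1 : ℝ)) p| ≤ 1 := by
      by_cases hp : p ∈ S <;> simp [hp]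
    calc |S.indicator (fun _ => (1 : ℝ)) p| * |h i n p| ≤ 1 * |Ch| :=
          mul_le_mul h1 ((hCh i n p).trans (le_abs_self _)) (abs_nonneg _) zero_le_one
      _ = |Ch| := one_mul _
  have hkey := integral_pastFn_mul_sub_kappa_eq_zero hσ hσ2 Φ r hg hgb i n hFm hFb
  refine (integral_congr_ae ?_).trans hkey
  have hgood : ∀ᵐ z ∂ν, z ∈ Φ.good := mem_ae_iff.2 (localGibbsLaw_compl_good_eq_zero Φ)
  filter_upwards [hgood, ae_lt_cnt_iff_mem_Ioc one_pos one_pos (0 : V3) hσ2 Φ τ i] with z hz hcnt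
  have htz : (past Φ r z i n).2.2.2 = Φ.nthCollisionTimeOf i n z := by simp [past, hz]
  have hFz : F (past Φ r z i n) = (if Φ.nthCollisionTimeOf i n z ∈ Ioc 0 τ ∧
      (t₁ < Φ.nthCollisionTimeOf i n z ∧ Φ.nthCollisionTimeOf i n z ≤ t₂) then (1 : ℝ) else 0) * h i n (past Φ r z i n) := by
    rw [hFdef]; dsimp only
    rw [indicator_apply]
    simp only [hSdef, mem_setOf_eq, htz]
  rw [hFz]
  by_cases hc : n < cnt Φ τ z i
  · have ht : Φ.nthCollisionTimeOf i n z ∈ Ioc 0 τ := (hcnt n).1 hc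
    by_cases hw : t₁ < Φ.nthCollisionTimeOf i n z ∧ Φ.nthCollisionTimeOf i n z ≤ t₂
    · simp [hc, ht, hw]
    · simp [hc, hw]
  · have ht : ¬ (Φ.nthCollisionTimeOf i n z ∈ Ioc 0 τ) := fun h' => hc ((hcnt n).2 h')
    simp [hc, ht]

/-- Truncating a `range`-sum at a larger bound changes nothing: for `k ≤ M`,
`Σ_{n < M} (if n < k then a n else 0) = Σ_{n < k} a n`. [folklore] -/
theorem sum_range_ite_lt_eq {a : ℕ → ℝ} {k M : ℕ} (hkM : k ≤ M) :
    ∑ n ∈ Finset.range M, (if n < k then a n else 0) = ∑ n ∈ Finset.range k, a n := by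
  rw [Finset.sum_ite, Finset.sum_const_zero, add_zero]
  congr 1
  ext n
  simp only [Finset.mem_filter, Finset.mem_range]
  omega

/-- **THE WINDOWED CENTRED KICK SUM HAS `G`-MEAN EXACTLY ZERO** (every horizon, mesh, window, bounded continuous `g`,
measurable weights `|h| ≤ 1`; `0 < σ < σ₀` the integrability threshold of `exists_integrable_countFn`, `N ≥ 1`):
`∫ Z_{(t₁,t₂]} dG = 0` for `G = localGibbsLaw σ 1 0 1 N Φ`. This is the restart-bias statement R-i″ with the level set `B`
replaced by the whole space, for ALL indices `n`: the random number of summands `cnt_i(τ)` is exchanged with the integral by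
dominated convergence (`|partial sums| ≤ 2C · countFn`, integrable), and each summand has mean zero
(`integral_windowTerm_eq_zero`). [folklore] -/
theorem integral_slotSum_eq_zero :
    ∃ σ₀ : ℝ, 0 < σ₀ ∧ ∀ σ : ℝ, 0 < σ → σ < σ₀ → ∀ N : ℕ, 1 ≤ N → ∀ Φ : Flow σ N, ∀ τ r t₁ t₂ : ℝ,
    ∀ g : V3 × V3 × V3 → ℝ, Continuous g → (∃ C : ℝ, ∀ p, |g p| ≤ C) →
    ∀ h : Fin (N + 1) → ℕ → Past N → ℝ, (∀ i n, Measurable (h i n)) → (∀ i n p, |h i n p| ≤ 1) →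
    ∫ z, slotSum Φ τ r t₁ t₂ g h z ∂(localGibbsLaw σ (fun _ => 1) (fun _ => 0) (fun _ => 1) N Φ) = 0 := by
  obtain ⟨σ₀, hσ₀, hW⟩ := exists_integrable_countFn
  refine ⟨min σ₀ (1 / 2), lt_min hσ₀ (by norm_num), fun σ hσ hσlt N hN Φ τ r t₁ t₂ g hg hgb h hh hhb => ?_⟩
  have hσ₀' : σ < σ₀ := hσlt.trans_le (min_le_left _ _)
  have hσ2 : σ ≤ 1 / 2 := (hσlt.trans_le (min_le_right _ _)).le
  obtain ⟨C, hC⟩ := hgb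
  have hC0 : 0 ≤ C := (abs_nonneg _).trans (hC 0)
  set ν : Measure (Phase N) := localGibbsLaw σ (fun _ => (1 : ℝ)) (fun _ => (0 : V3)) (fun _ => (1 : ℝ)) N Φ with hν
  haveI : IsProbabilityMeasure ν := isProbabilityMeasure_localGibbsLaw continuous_const continuous_const
    continuous_const (fun _ => one_pos) (fun _ => one_pos) hσ2 N Φ
  have hν0 : ν Φ.goodᶜ = 0 := localGibbsLaw_compl_good_eq_zero Φ
  have hgood : ∀ᵐ z ∂ν, z ∈ Φ.good := mem_ae_iff.2 hν0
  have hε : 0 ≤ hsDiameter σ N / ((N : ℝ) + 1) := div_nonneg (hsDiameter_pos hσ N).le (by positivity)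
  -- the summands (opaque local constants, unfolded only through `ha` / `hP`)
  obtain ⟨a, ha⟩ : ∃ a : Fin (N + 1) → ℕ → Phase N → ℝ, ∀ i n z, a i n z =
      (if t₁ < Φ.nthCollisionTimeOf i n z ∧ Φ.nthCollisionTimeOf i n z ≤ t₂ then (1 : ℝ) else 0) *
        (h i n (past Φ r z i n) * (g (kick Φ i n z) - kappa Φ r g i n z)) := ⟨_, fun _ _ _ => rfl⟩
  obtain ⟨P, hP⟩ : ∃ P : ℕ → Phase N → ℝ, ∀ M z, P M z =
      hsDiameter σ N / ((N : ℝ) + 1) * ∑ i : Fin (N + 1), ∑ n ∈ Finset.range M,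
        (if n < cnt Φ τ z i then a i n z else 0) := ⟨_, fun _ _ => rfl⟩
  have hslot : ∀ z, slotSum Φ τ r t₁ t₂ g h z =
      hsDiameter σ N / ((N : ℝ) + 1) * ∑ i : Fin (N + 1), ∑ n ∈ Finset.range (cnt Φ τ z i), a i n z := by
    intro z
    simp only [slotSum, ha]
  -- (0) pointwise bound of a guarded summand, when `|κ| ≤ C`
  have hterm : ∀ i n z, (∀ i n, |kappa Φ r g i n z| ≤ C) →
      |(if n < cnt Φ τ z i then a i n z else 0)| ≤ (if n < cnt Φ τ z i then 2 * C else 0) := by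
    intro i n z hκ
    by_cases hc : n < cnt Φ τ z i
    · rw [if_pos hc, if_pos hc, ha, abs_mul, abs_mul]
      have h1 : |(if t₁ < Φ.nthCollisionTimeOf i n z ∧ Φ.nthCollisionTimeOf i n z ≤ t₂ then (1 : ℝ) else 0)| ≤ 1 := by
        split_ifs <;> simp
      have h3 : |g (kick Φ i n z) - kappa Φ r g i n z| ≤ 2 * C :=
        (abs_sub _ _).trans (by linarith [hC (kick Φ i n z), hκ i n])
      calc _ ≤ 1 * (1 * (2 * C)) :=
            mul_le_mul h1 (mul_le_mul (hhb i n _) h3 (abs_nonneg _) zero_le_one) (by positivity) zero_le_one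
        _ = 2 * C := by ring
    · rw [if_neg hc, if_neg hc, abs_zero]
  -- (1) each guarded summand is integrable with integral zero
  have ha_meas_good : ∀ i n, Measurable fun z => (if n < gcnt Φ τ z i then slotTerm Φ r t₁ t₂ g h i n z else 0) := by
    intro i n
    refine Measurable.ite ?_ (measurable_slotTerm stub_pastMeasurable hσ Φ r t₁ t₂ hg hh i n) measurable_const
    exact measurableSet_lt measurable_const ((measurable_from_top (f := fun m : ℕ => m)).comp
      (measurable_gcnt stub_pastMeasurable hσ Φ τ i))
  have ha_ae : ∀ i n, (fun z => (if n < cnt Φ τ z i then a i n z else 0)) =ᵐ[ν]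
      fun z => (if n < gcnt Φ τ z i then slotTerm Φ r t₁ t₂ g h i n z else 0) := by
    intro i n
    filter_upwards [hgood] with z hz
    simp only [ha, gcnt, slotTerm, hz, if_true, pastTime_of_mem_good Φ r hz]
  have ha_aesm : ∀ i n, AEStronglyMeasurable (fun z => (if n < cnt Φ τ z i then a i n z else 0)) ν := fun i n =>
    ⟨_, (ha_meas_good i n).stronglyMeasurable, ha_ae i n⟩
  have hκae := ae_forall_abs_kappa_le Φ r hC
  have ha_bd : ∀ i n, ∀ᵐ z ∂ν, ‖(if n < cnt Φ τ z i then a i n z else 0)‖ ≤ 2 * C := by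
    intro i n
    filter_upwards [hκae] with z hκ
    rw [Real.norm_eq_abs]
    refine (hterm i n z hκ).trans ?_
    split_ifs
    · exact le_rfl
    · positivity
  have ha_int : ∀ i n, Integrable (fun z => (if n < cnt Φ τ z i then a i n z else 0)) ν := fun i n =>
    Integrable.of_bound (ha_aesm i n) (2 * C) (ha_bd i n)
  have ha_zero : ∀ i n, ∫ z, (if n < cnt Φ τ z i then a i n z else 0) ∂ν = 0 := by
    intro i n
    have h0 := integral_windowTerm_eq_zero hσ hσ2 Φ τ r t₁ t₂ hg ⟨C, hC⟩ hh ⟨1, hhb⟩ i n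
    refine (integral_congr_ae (Eventually.of_forall fun z => ?_)).trans h0
    simp only [ha]
  have hP_zero : ∀ M, ∫ z, P M z ∂ν = 0 := by
    intro M
    simp only [hP]
    rw [integral_const_mul, integral_finsetSum (f := fun i z => ∑ n ∈ Finset.range M,
      (if n < cnt Φ τ z i then a i n z else 0)) Finset.univ (fun i _ =>
        integrable_finsetSum (f := fun n z => (if n < cnt Φ τ z i then a i n z else 0)) (Finset.range M)
          fun n _ => ha_int i n)]
    have hinner : ∀ i : Fin (N + 1), ∫ z, ∑ n ∈ Finset.range M, (if n < cnt Φ τ z i then a i n z else 0) ∂ν = 0 := by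
      intro i
      rw [integral_finsetSum (f := fun n z => (if n < cnt Φ τ z i then a i n z else 0)) (Finset.range M)
        fun n _ => ha_int i n]
      exact Finset.sum_eq_zero fun n _ => ha_zero i n
    rw [Finset.sum_eq_zero fun i _ => hinner i, mul_zero]
  -- (2) the truncated sums are eventually equal to the windowed kick sum, pointwise
  have hP_tend : ∀ᵐ z ∂ν, Tendsto (fun M => P M z) atTop (𝓝 (slotSum Φ τ r t₁ t₂ g h z)) := by
    refine Eventually.of_forall fun z => ?_
    obtain ⟨K, hK⟩ : ∃ K : ℕ, ∀ i, cnt Φ τ z i ≤ K :=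
      ⟨Finset.univ.sup fun i => cnt Φ τ z i, fun i => Finset.le_sup (f := fun i => cnt Φ τ z i) (Finset.mem_univ i)⟩
    refine tendsto_atTop_of_eventually_const (i₀ := K) fun M hM => ?_
    rw [hP, hslot]
    congr 1
    refine Finset.sum_congr rfl fun i _ => ?_
    exact sum_range_ite_lt_eq ((hK i).trans hM)
  -- (3) domination by `2C · countFn` on the good set
  have hP_bd : ∀ M, ∀ᵐ z ∂ν, ‖P M z‖ ≤ 2 * C * countFn Φ τ z := by
    intro M
    filter_upwards [hgood, hκae] with z hz hκ
    rw [Real.norm_eq_abs, hP]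
    unfold countFn
    rw [abs_mul, abs_of_nonneg hε, mul_comm (2 * C), mul_assoc]
    refine mul_le_mul_of_nonneg_left ?_ hε
    rw [Finset.sum_mul]
    refine (Finset.abs_sum_le_sum_abs _ _).trans (Finset.sum_le_sum fun i _ => ?_)
    simp only [hz, if_true]
    refine (Finset.abs_sum_le_sum_abs _ _).trans ?_
    calc ∑ n ∈ Finset.range M, |(if n < cnt Φ τ z i then a i n z else 0)|
        ≤ ∑ n ∈ Finset.range M, (if n < cnt Φ τ z i then 2 * C else 0) :=
          Finset.sum_le_sum fun n _ => hterm i n z hκ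
      _ = (((Finset.range M).filter fun n => n < cnt Φ τ z i).card : ℝ) * (2 * C) := by
          rw [Finset.sum_ite, Finset.sum_const_zero, add_zero, Finset.sum_const, nsmul_eq_mul]
      _ ≤ (cnt Φ τ z i : ℝ) * (2 * C) := by
          refine mul_le_mul_of_nonneg_right ?_ (by positivity)
          have hsub : ((Finset.range M).filter fun n => n < cnt Φ τ z i) ⊆ Finset.range (cnt Φ τ z i) := by
            intro n hn
            simp only [Finset.mem_filter, Finset.mem_range] at hn ⊢
            exact hn.2
          exact_mod_cast (Finset.card_le_card hsub).trans (Finset.card_range _).le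
  -- (4) dominated convergence
  have hbound_int : Integrable (fun z => 2 * C * countFn Φ τ z) ν := (hW σ hσ hσ₀' N hN Φ τ).const_mul (2 * C)
  have hP_aesm : ∀ M, AEStronglyMeasurable (P M) ν := by
    intro M
    have : P M = fun z => hsDiameter σ N / ((N : ℝ) + 1) * ∑ i : Fin (N + 1), ∑ n ∈ Finset.range M,
        (if n < cnt Φ τ z i then a i n z else 0) := funext fun z => hP M z
    rw [this]
    have hsum : AEStronglyMeasurable (fun z => ∑ i : Fin (N + 1), ∑ n ∈ Finset.range M,
        (if n < cnt Φ τ z i then a i n z else 0)) ν := by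
      refine Finset.aestronglyMeasurable_fun_sum Finset.univ fun i _ => ?_
      exact Finset.aestronglyMeasurable_fun_sum (Finset.range M) fun n _ => ha_aesm i n
    exact hsum.const_mul _
  have hlim : Tendsto (fun M => ∫ z, P M z ∂ν) atTop (𝓝 (∫ z, slotSum Φ τ r t₁ t₂ g h z ∂ν)) :=
    tendsto_integral_of_dominated_convergence (fun z => 2 * C * countFn Φ τ z) hP_aesm hbound_int hP_bd hP_tend
  have hconst : Tendsto (fun M => ∫ z, P M z ∂ν) atTop (𝓝 0) := by
    simp_rw [hP_zero]; exact tendsto_const_nhds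
  exact tendsto_nhds_unique hlim hconst

/-- On the good set, the SECOND photo of the typed past `P_{i,n}` is the coarse configuration at the partner's flight
start `s_q = (P_{i,n}).2.2.1`. [folklore] -/
theorem past_snd_photo (Φ : Flow σ N) (r : ℝ) {z : Phase N} (hz : z ∈ Φ.good) (i : Fin (N + 1)) (n : ℕ) :
    (past Φ r z i n).1.1.2 = coarseConfig (Torus.coarseCell r) (Φ.flow (past Φ r z i n).2.2.1 z) := by
  simp only [past, hz, if_true, HardSphereFlow.coarsePastOf]

/-- **Kicks by partners on their FIRST flight are exactly fair on key level sets, for every index `n`** (extends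
`firstKickFair`, the case `n = 0` where `i` itself is on its first flight): for weights `h_{i,n}` vanishing unless the
partner's flight start `s_q = p.2.2.1` is `0`, `∫_{cellKey r w = β} 1{n < cnt_i} 1{t_{i,n} ∈ (t₁,t₂]} h(P_{i,n})(g(X_{i,n}) − κ_{i,n}) dG
= 0`. Indeed when `s_q = 0` the second photo of `P_{i,n}` is the coarse configuration AT TIME ZERO (`past_snd_photo`), of which
the key is a measurable function; with `ae_lt_cnt_iff_mem_Ioc` the whole weight is past-measurable and the pull-out applies.
So the content of the restart-bias stub R-i″ lies entirely in collisions between two spheres that have BOTH collided before.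
[folklore] -/
theorem partnerFirstFlightFair (hσ : 0 < σ) (hσ2 : σ ≤ 1 / 2) (Φ : Flow σ N) (τ r w t₁ t₂ : ℝ)
    {g : V3 × V3 × V3 → ℝ} (hg : Continuous g) (hgb : ∃ C : ℝ, ∀ p, |g p| ≤ C)
    {h : Fin (N + 1) → ℕ → Past N → ℝ} (hh : ∀ i n, Measurable (h i n)) (hhb : ∃ Ch : ℝ, ∀ i n p, |h i n p| ≤ Ch)
    (hcut : ∀ i n p, p.2.2.1 ≠ 0 → h i n p = 0)
    (β : (Fin 3 → ℤ) → ℕ × (Fin 3 → ℤ) × ℤ) (i : Fin (N + 1)) (n : ℕ) :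
    ∫ z in {z | cellKey r w z = β},
      (if n < cnt Φ τ z i then
        (if t₁ < Φ.nthCollisionTimeOf i n z ∧ Φ.nthCollisionTimeOf i n z ≤ t₂ then (1 : ℝ) else 0) *
          (h i n (past Φ r z i n) * (g (kick Φ i n z) - kappa Φ r g i n z)) else 0)
      ∂(localGibbsLaw σ (fun _ => 1) (fun _ => 0) (fun _ => 1) N Φ) = 0 := by
  obtain ⟨Ch, hCh⟩ := hhb
  set ν : Measure (Phase N) := localGibbsLaw σ (fun _ => (1 : ℝ)) (fun _ => (0 : V3)) (fun _ => (1 : ℝ)) N Φ with hν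
  set S : Set (Past N) := {p | photoKey w p.1.1.2 = β ∧ p.2.2.2 ∈ Ioc 0 τ ∧ (t₁ < p.2.2.2 ∧ p.2.2.2 ≤ t₂)} with hSdef
  have htime : Measurable fun p : Past N => p.2.2.2 := measurable_snd.snd.snd
  have hSm : MeasurableSet S := by
    refine MeasurableSet.inter ?_ (MeasurableSet.inter ?_ ?_)
    · exact (measurableSet_photoKey_eq w β).preimage measurable_fst.fst.snd
    · exact htime measurableSet_Ioc
    · exact (measurableSet_lt measurable_const htime).inter (measurableSet_le htime measurable_const)
  set F : Past N → ℝ := fun p => S.indicator (fun _ => (1 : ℝ)) p * h i n p with hFdef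
  have hFm : Measurable F := (measurable_const.indicator hSm).mul (hh i n)
  have hFb : ∃ CF : ℝ, ∀ p, |F p| ≤ CF := by
    refine ⟨|Ch|, fun p => ?_⟩
    rw [hFdef]; dsimp only
    rw [abs_mul]
    have h1 : |S.indicator (fun _ => (1 : ℝ)) p| ≤ 1 := by
      by_cases hp : p ∈ S <;> simp [hp]
    calc |S.indicator (fun _ => (1 : ℝ)) p| * |h i n p| ≤ 1 * |Ch| :=
          mul_le_mul h1 ((hCh i n p).trans (le_abs_self _)) (abs_nonneg _) zero_le_one
      _ = |Ch| := one_mul _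
  have hkey := integral_pastFn_mul_sub_kappa_eq_zero hσ hσ2 Φ r hg hgb i n hFm hFb
  have hBm : MeasurableSet {z : Phase N | cellKey r w z = β} := measurableSet_cellKey_eq r w β
  rw [← integral_indicator hBm]
  refine (integral_congr_ae ?_).trans hkey
  have hgood : ∀ᵐ z ∂ν, z ∈ Φ.good := mem_ae_iff.2 (localGibbsLaw_compl_good_eq_zero Φ)
  filter_upwards [hgood, ae_lt_cnt_iff_mem_Ioc one_pos one_pos (0 : V3) hσ2 Φ τ i] with z hz hcnt
  have htz : (past Φ r z i n).2.2.2 = Φ.nthCollisionTimeOf i n z := by simp [past, hz]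
  simp only [indicator_apply, mem_setOf_eq]
  by_cases hsq : (past Φ r z i n).2.2.1 = 0
  · -- partner on its first flight: the second photo is the time-zero coarse configuration
    have hphoto : photoKey w (past Φ r z i n).1.1.2 = cellKey r w z := by
      rw [past_snd_photo Φ r hz i n, hsq, Φ.flow_zero z hz, ← cellKey_eq_photoKey]
    have hFz : F (past Φ r z i n) = (if cellKey r w z = β ∧ Φ.nthCollisionTimeOf i n z ∈ Ioc 0 τ ∧
        (t₁ < Φ.nthCollisionTimeOf i n z ∧ Φ.nthCollisionTimeOf i n z ≤ t₂) then (1 : ℝ) else 0) * h i n (past Φ r z i n) := by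
      rw [hFdef]; dsimp only
      rw [indicator_apply]
      simp only [hSdef, mem_setOf_eq, hphoto, htz]
    rw [hFz]
    by_cases hB : cellKey r w z = β
    · by_cases hc : n < cnt Φ τ z i
      · have ht : Φ.nthCollisionTimeOf i n z ∈ Ioc 0 τ := (hcnt n).1 hc
        by_cases hwin : t₁ < Φ.nthCollisionTimeOf i n z ∧ Φ.nthCollisionTimeOf i n z ≤ t₂
        · simp [hB, hc, ht, hwin]
        · simp [hB, hc, hwin]
      · have ht : ¬ (Φ.nthCollisionTimeOf i n z ∈ Ioc 0 τ) := fun h' => hc ((hcnt n).2 h')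
        simp [hB, hc, ht]
    · simp [hB]
  · -- otherwise the weight vanishes on both sides
    have h0 : h i n (past Φ r z i n) = 0 := hcut i n _ hsq
    have hF0 : F (past Φ r z i n) = 0 := by rw [hFdef]; dsimp only; rw [h0, mul_zero]
    rw [hF0, h0]
    simp

end Fair

end Summit.AtomisticToContinuum.HydrodynamicLimit.Theorems.KickFairRelEquilibriumMesoLine

end
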